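import Summits.ABC.ABC.Theses.CubicResolventAllowance
import Summits.ABC.ABC.Theorems.CubicResolventAllowanceResolventDiscBounds
import Summits.ABC.ABC.Theorems.TwoTorsionDictionary
import Literature.NumberTheory.DiophantineGeometry.GenEllThm21With
import Literature.NumberTheory.EllipticCurves.JInvariantDenominator
import Literature.NumberTheory.EllipticCurves.GlobalMinimalModelProofs
import Literature.NumberTheory.EllipticCurves.SzpiroOfAbcProofs
import Literature.NumberTheory.EllipticCurves.SzpiroLocalDataProofs
import Literature.NumberTheory.DiophantineGeometry.EllArithGlueProofs
import Literature.NumberTheory.NumberFields.PureCubicDiscriminantBound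
import Literature.NumberTheory.NumberFields.PureCubicDegreeOnePrimes
import HarnessLib

/-!
# STUB-IDEAS `stub_complexCubic` · ideator k1 · generation 6 — the stub is poly-abc in disguise

Crux stmt-ABC-22740 `CubicResolventAllowance.IndexSzpiro`, stub `stub_complexCubic` (the `d_K < 0` half),
route-ABC-CubicResolventAllowance. FAMILY 1 (recognise & import), gen 6.

Gens 2–5 of this slot imported everything importable TOWARDS the stub and found it open-problem strength.
Gen 6 imports in the OTHER direction and makes that precise, by name, over the tree's vocabulary
`Literature.NumberTheory.DiophantineGeometry.GenEll.ABCWithExponent`: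

  `ABC (= abc₁)  ⟹  SzpiroConjecture  ⟹  Stub  ⟹  ABCWithExponent 8`   (and `⟹ ABCWithExponent 7`).

The first arrow is the tree's `szpiro_of_abcLe_holds`; the second is `stub_of_szpiro` below (trivial);
the third is NEW and is the content of this file: the PURE-CUBIC (Γ²-twisted Hessian) PENCIL

  `E_{x,y} : Y² = X³ + 108·xy·X + 216·xy·(y − x)`,   `x + y = z` a role assignment of an abc triple,

has `c₄ = −2⁶3⁴·xy`, `Δ = −2¹⁰3⁹·(xyz)² < 0` (so `d_K < 0` for every resolvent cubic field, K7b of gen 5),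
`j = 6912·xy/z²` (so `z² ∣ 6912·Δ_min`), 2-division field `ℚ(∛(xy²))` (root `6(φ − θ)`, `φ³ = x²y`,
`θ³ = xy²`), `ψ₂` irreducible iff `xy²` is not a cube iff not both `|x|, |y|` are cubes — and Mathlib's
`fermatLastTheoremThree` guarantees that for EVERY abc triple some role assignment capturing `max(b, c) ≥ c/2`
qualifies; `N ∣ 2⁸3⁵·rad(xyz)²`. Feeding `E_{x,y}` and `K = ℚ(∛(xy²))` to the stub gives
`z² ≤ 6912·C(ε)·|d_K|·N^{6+ε}` with `|d_K| ≤ 1944 N²` (CLOSED support `ResolventDiscBounds`) or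
`|d_K| ≤ 27·rad(xy)²` (tree `PureCubic.abs_discr_le`), i.e. `c ≪_ε rad(abc)^{8+ε}` (resp. `7+ε`).

Certified numerically: kit job j344733 (PARI; 23454 curves = all coprime `a + b = c ≤ 160` × 3 roles + 14
famous triples; 0 violations of C1–C7; `max |d_K|/rad(xy)² = 27`).

Statements only (`sorry` in helper bodies = the proposals); the identities T1/T2, the sandwich maps and the
FLT(3) core are kernel-checked. Nothing here proves the stub: the file proves the stub is abc-hard.
-/

set_option linter.dupNamespace false

noncomputable section

namespace Summit.ABC.ABC.Cruxes.IndexSzpiro.StubIdeasComplexCubic1G6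

open Polynomial UniqueFactorizationMonoid WeierstrassCurve
open Literature.NumberTheory.EllipticCurves Literature.NumberTheory.DiophantineGeometry

/-- The stub, verbatim (payload `stub.signature`; = `IndexSzpiro` with the extra hypothesis `d_K < 0`). -/
def Stub : Prop :=
  ∀ ε : ℝ, 0 < ε → ∃ C : ℝ, ∀ (W : WeierstrassCurve ℚ) [W.IsElliptic] (K : Type) [Field K] [NumberField K],
    Irreducible W.twoTorsionPolynomial.toPoly → Module.finrank ℚ K = 3 →
    (∃ θ : K, aeval θ W.twoTorsionPolynomial.toPoly = 0) → NumberField.discr K < 0 →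
    (W.minimalDiscriminantNorm ℤ : ℝ) ≤ C * |(NumberField.discr K : ℝ)| * (W.conductorNorm ℤ : ℝ) ^ (6 + ε)

/-! ## T0 — the sandwich maps that are already formal (kernel-checked) -/

/-- The route crux gives the stub (drop the sign hypothesis). [folklore] -/
theorem stub_of_indexSzpiro (h : Summit.ABC.ABC.Theses.CubicResolventAllowance.IndexSzpiro) : Stub := by
  intro ε hε
  obtain ⟨C, hC⟩ := h ε hε
  exact ⟨C, fun W _ K _ _ hirr h3 hθ _ => hC W K hirr h3 hθ⟩

/-- Szpiro's conjecture gives the stub (`|d_K| ≥ 1`); with the tree's `szpiro_of_abcLe_holds`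
(Silverman AEC VIII.11.5(b)) this places the stub BELOW abc. [folklore] -/
theorem stub_of_szpiro (h : SzpiroConjecture) : Stub := by
  intro ε hε
  obtain ⟨C, hC⟩ := h ε hε
  refine ⟨max C 0, fun W _ K _ _ _ _ _ _ => ?_⟩
  have h1 := hC W
  have hN : (0 : ℝ) ≤ (W.conductorNorm ℤ : ℝ) ^ (6 + ε) := by positivity
  have hd : (1 : ℝ) ≤ |(NumberField.discr K : ℝ)| := by
    have := Int.one_le_abs (NumberField.discr_ne_zero K)
    exact_mod_cast this
  calc (W.minimalDiscriminantNorm ℤ : ℝ) ≤ C * (W.conductorNorm ℤ : ℝ) ^ (6 + ε) := h1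
    _ ≤ max C 0 * (W.conductorNorm ℤ : ℝ) ^ (6 + ε) := by gcongr; exact le_max_left _ _
    _ = max C 0 * 1 * (W.conductorNorm ℤ : ℝ) ^ (6 + ε) := by ring
    _ ≤ max C 0 * |(NumberField.discr K : ℝ)| * (W.conductorNorm ℤ : ℝ) ^ (6 + ε) := by
        gcongr

/-! ## T1 — the pure-cubic pencil and its invariants (kernel-checked) -/

/-- The integral pencil `E_{x,y} : Y² = X³ + 108xy·X + 216xy(y − x)` (the Hessian/Γ² family
`j = 6912 xy/(x+y)²`, twisted so that its 2-division field is `ℚ(∛(xy²))`). -/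
def pencilInt (x y : ℤ) : WeierstrassCurve ℤ := ⟨0, 0, 0, 108 * x * y, 216 * x * y * (y - x)⟩

/-- `E_{x,y}` over `ℚ`. -/
abbrev pencil (x y : ℤ) : WeierstrassCurve ℚ := (pencilInt x y).baseChange ℚ

/-- T1a (kernel-checked). `c₄(E_{x,y}) = −2⁶·3⁴·xy`: a prime `p ≥ 5` of `z = x + y` (coprime to `xy`)
does not divide `c₄` — multiplicative reduction, no exponent loss. [folklore] -/
theorem pencilInt_c₄ (x y : ℤ) : (pencilInt x y).c₄ = -(2 ^ 6 * 3 ^ 4) * (x * y) := by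
  simp only [pencilInt, WeierstrassCurve.c₄, WeierstrassCurve.b₂, WeierstrassCurve.b₄]
  ring

/-- T1b (kernel-checked). `Δ(E_{x,y}) = −2¹⁰·3⁹·(xy(x+y))²` — NEGATIVE for every real specialisation,
so the pencil lives in the stub's class `𝒞⁻`. [folklore] -/
theorem pencilInt_Δ (x y : ℤ) : (pencilInt x y).Δ = -(2 ^ 10 * 3 ^ 9) * (x * y * (x + y)) ^ 2 := by
  simp only [pencilInt, WeierstrassCurve.Δ, WeierstrassCurve.b₂, WeierstrassCurve.b₄, WeierstrassCurve.b₆,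
    WeierstrassCurve.b₈]
  ring

/-- T1b′ (kernel-checked). `Δ(E_{x,y}/ℚ)`. [folklore] -/
theorem pencil_Δ (x y : ℤ) :
    (pencil x y).Δ = -(2 ^ 10 * 3 ^ 9 : ℚ) * ((x : ℚ) * y * (x + y)) ^ 2 := by
  rw [pencil, WeierstrassCurve.baseChange, WeierstrassCurve.map_Δ, pencilInt_Δ, eq_intCast]
  push_cast
  ring

/-- T1b″ (kernel-checked). `Δ(E_{x,y}/ℚ)`'s `c₄`. [folklore] -/
theorem pencil_c₄ (x y : ℤ) : (pencil x y).c₄ = -(2 ^ 6 * 3 ^ 4 : ℚ) * ((x : ℚ) * y) := by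
  rw [pencil, WeierstrassCurve.baseChange, WeierstrassCurve.map_c₄, pencilInt_c₄, eq_intCast]
  push_cast
  ring

/-- T1c (kernel-checked). `E_{x,y}` is elliptic as soon as `xy(x+y) ≠ 0`. [folklore] -/
theorem pencil_isElliptic {x y : ℤ} (hx : x ≠ 0) (hy : y ≠ 0) (hz : x + y ≠ 0) :
    (pencil x y).IsElliptic := by
  refine ⟨?_⟩
  rw [pencil_Δ, isUnit_iff_ne_zero]
  have hx' : (x : ℚ) ≠ 0 := by exact_mod_cast hx
  have hy' : (y : ℚ) ≠ 0 := by exact_mod_cast hy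
  have hz' : ((x : ℚ) + y) ≠ 0 := by exact_mod_cast hz
  exact mul_ne_zero (by norm_num) (pow_ne_zero 2 (mul_ne_zero (mul_ne_zero hx' hy') hz'))

/-- T1d (kernel-checked). `j(E_{x,y}) = 6912·xy/(x+y)²`: the member `z = x + y` of the triple is the
denominator of `j`, prime to the numerator when `gcd(x, y) = 1`. [folklore] -/
theorem pencil_j {x y : ℤ} (hx : x ≠ 0) (hy : y ≠ 0) (hz : x + y ≠ 0) [(pencil x y).IsElliptic] :
    (pencil x y).j = 6912 * ((x : ℚ) * y) / ((x : ℚ) + y) ^ 2 := by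
  have hx' : (x : ℚ) ≠ 0 := by exact_mod_cast hx
  have hy' : (y : ℚ) ≠ 0 := by exact_mod_cast hy
  have hz' : ((x : ℚ) + y) ≠ 0 := by exact_mod_cast hz
  rw [WeierstrassCurve.j, Units.val_inv_eq_inv_val, WeierstrassCurve.coe_Δ', pencil_Δ, pencil_c₄]
  field_simp
  ring

/-! ## T2 — root transport: the 2-division field is the pure cubic field `ℚ(∛(xy²))` (kernel-checked) -/

/-- T2 (kernel-checked). In any `ℚ`-algebra field, if `φ³ = x²y`, `θ³ = xy²`, `φθ = xy` then `6(φ − θ)` is a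
root of `ψ₂(E_{x,y}) = 4X³ + 432xy·X + 864xy(y − x)` (`u = φ − θ` satisfies `u³ + 3xy·u + xy(y − x) = 0`).
Hence `ℚ(E_{x,y}[2])⁺ = ℚ(θ) = ℚ(∛(xy²))` (`φ = xy/θ`). [folklore] -/
theorem pencil_root {K : Type} [Field K] [Algebra ℚ K] (x y : ℤ) (φ θ : K)
    (hφ : φ ^ 3 = (x : K) ^ 2 * y) (hθ : θ ^ 3 = (x : K) * y ^ 2) (hφθ : φ * θ = (x : K) * y) :
    aeval (6 * (φ - θ)) (pencil x y).twoTorsionPolynomial.toPoly = 0 := by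
  simp only [pencil, pencilInt, WeierstrassCurve.baseChange, WeierstrassCurve.map,
    WeierstrassCurve.twoTorsionPolynomial, Cubic.toPoly, WeierstrassCurve.b₂, WeierstrassCurve.b₄,
    WeierstrassCurve.b₆]
  simp only [map_add, map_mul, map_pow, map_sub, aeval_X, map_ofNat, map_zero, map_intCast,
    eq_intCast]
  linear_combination (864 : K) * hφ - (864 : K) * hθ - (2592 : K) * (φ - θ) * hφθ

/-! ## T3 — irreducibility of `ψ₂` ⟺ `xy²` not a cube (M) -/

/-- T3 (M). For `xy(x+y) ≠ 0` and `xy²` not a rational cube, `ψ₂(E_{x,y})` is irreducible over `ℚ`.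
Proof: a cubic over a field is irreducible iff it has no root (Mathlib
`Polynomial.irreducible_iff_roots_eq_zero_of_degree_le_three`); a rational root `6u₀` would make
`θ = ∛(xy²)` a root of `X² + u₀X − xy ∈ ℚ[X]` (`φ = xy/θ`, T2), contradicting `deg minpoly θ = 3`
(`X³ − xy²` irreducible: tree `PureCubic.irreducible_polyQ` / Mathlib `X_pow_sub_C_irreducible_of_prime`).
Certified: j344733 check C5 (23418/23454 irreducible, the 36 reducible ones exactly the both-cubes pairs). [folklore] -/
theorem pencil_irreducible {x y : ℤ} (hx : x ≠ 0) (hy : y ≠ 0) (hz : x + y ≠ 0)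
    (hcube : ∀ r : ℚ, r ^ 3 ≠ (x : ℚ) * y ^ 2) :
    Irreducible (pencil x y).twoTorsionPolynomial.toPoly := by
  sorry

/-- T3′ (S). For coprime integers, `xy²` a rational cube ⟹ `x` and `y` are integer cubes
(integer-root theorem `irrational_nrt_of_notint_nrt` / `Int.eq_pow_of_mul_eq_pow_odd`; units of `ℤ` are cubes). [folklore] -/
theorem cubes_of_cube {x y : ℤ} (hxy : IsCoprime x y) (hx : x ≠ 0) (hy : y ≠ 0)
    (h : ∃ r : ℚ, r ^ 3 = (x : ℚ) * y ^ 2) : (∃ m : ℤ, x = m ^ 3) ∧ ∃ n : ℤ, y = n ^ 3 := by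
  sorry

/-! ## T4 — a resolvent cubic field exists and is complex (S) -/

set_option linter.unusedTactic false in
set_option linter.unreachableTactic false in
/-- T4a (kernel-checked, generic). An irreducible 2-division cubic has a stem field: a number field `K` of
degree `3` with a root of `ψ₂` (`AdjoinRoot ψ₂`, `AdjoinRoot.powerBasis`, `NumberField.mk`). [folklore] -/
theorem exists_cubicField (W : WeierstrassCurve ℚ) (hirr : Irreducible W.twoTorsionPolynomial.toPoly) :
    ∃ (K : Type) (_ : Field K) (_ : NumberField K),
      Module.finrank ℚ K = 3 ∧ ∃ θ : K, aeval θ W.twoTorsionPolynomial.toPoly = 0 := by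
  classical
  set f := W.twoTorsionPolynomial.toPoly with hf
  haveI : Fact (Irreducible f) := ⟨hirr⟩
  have hf0 : f ≠ 0 := hirr.ne_zero
  have ha : W.twoTorsionPolynomial.a ≠ 0 := by
    rw [WeierstrassCurve.twoTorsionPolynomial]; norm_num
  have hdeg : f.natDegree = 3 := Cubic.natDegree_of_a_ne_zero ha
  haveI : Module.Finite ℚ (AdjoinRoot f) := (AdjoinRoot.powerBasis hf0).finite
  haveI : CharZero (AdjoinRoot f) := charZero_of_injective_algebraMap (algebraMap ℚ (AdjoinRoot f)).injective
  letI : NumberField (AdjoinRoot f) := NumberField.mk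
  refine ⟨AdjoinRoot f, inferInstance, inferInstance, ?_, AdjoinRoot.root f, ?_⟩
  · rw [(AdjoinRoot.powerBasis hf0).finrank, AdjoinRoot.powerBasis_dim, hdeg]
  · -- the statement's `Algebra ℚ K` is `algebraRat`; AdjoinRoot's is the quotient algebra: equal
    -- (`algebra_rat_subsingleton`), crossed by `convert`.
    have h := AdjoinRoot.aeval_eq (f := f) f
    rw [AdjoinRoot.mk_self, Polynomial.aeval_def] at h
    rw [Polynomial.aeval_def]
    convert h using 2
    all_goals first | rfl | exact Subsingleton.elim _ _

/-- T4b = gen-5 K7b `discr_neg_iff_Δ_neg` (kernel-checked in `Cruxes/IndexSzpiro/StubIdeas1G5Sketch.lean`,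
ZERO sorries), restated as the input this line consumes: a cubic field containing a root of the irreducible
`ψ₂` of a curve with `Δ < 0` is complex. With T1b every pencil fibre is in the stub's class. [folklore] -/
def SignDoor : Prop :=
  ∀ (W : WeierstrassCurve ℚ) [W.IsElliptic] (K : Type) [Field K] [NumberField K],
    Irreducible W.twoTorsionPolynomial.toPoly → Module.finrank ℚ K = 3 →
    (∃ θ : K, aeval θ W.twoTorsionPolynomial.toPoly = 0) → W.Δ < 0 → NumberField.discr K < 0

/-- T4c (M, only for exponent 7). The sharp allowance of the pencil: a cubic field `K ∋ θ`, `θ³ = n`, `n` a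
nonzero non-cube integer, has `d_K < 0` and `|d_K| ≤ 27·rad(n)²` — normalise `n ≡ ab² (mod cubes)` with `ab`
squarefree, `ab ∣ rad n`, then tree `PureCubic.abs_discr_le` [Cohen1993 Thm 6.4.13] and
`PureCubic.discr_dedekindBasis`/`discr_eq_sq_mul_discr` for the sign. Certified: j344733 C6 (`max = 27`). [cite: Cohen1993, Thm. 6.4.13] -/
theorem pureCubic_allowance (K : Type) [Field K] [NumberField K] (h3 : Module.finrank ℚ K = 3)
    {n : ℤ} (hn0 : n ≠ 0) (hn : ∀ r : ℚ, r ^ 3 ≠ n) {θ : K} (hθ : θ ^ 3 = (n : K)) :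
    NumberField.discr K < 0 ∧ |NumberField.discr K| ≤ 27 * (radical n) ^ 2 := by
  sorry

/-! ## T5 — the captured member: `z² ∣ 6912·Δ_min(E_{x,y})` (S + S) -/

/-- T5a (kernel-checked). `den(j) ∣ |Δ_min|` for EVERY elliptic curve over `ℚ` (model-free form of the tree's
`den_j_dvd_natAbs_minimalDiscriminantInt`, via `hasGlobalMinimalModel_rat_holds`,
`minimalDiscriminantNorm_int_eq_natAbs_minimalDiscriminantInt_holds`, `minimalDiscriminantNorm_smul_rat`,
Mathlib `variableChange_j`). [folklore] -/
theorem den_j_dvd_minimalDiscriminantNorm (W : WeierstrassCurve ℚ) [W.IsElliptic] :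
    (W.j).den ∣ W.minimalDiscriminantNorm ℤ := by
  obtain ⟨C, hC⟩ := hasGlobalMinimalModel_rat_holds W
  haveI := hC
  have h1 := den_j_dvd_natAbs_minimalDiscriminantInt (C • W)
  rw [← minimalDiscriminantNorm_int_eq_natAbs_minimalDiscriminantInt_holds (C • W),
    minimalDiscriminantNorm_smul_rat, variableChange_j] at h1
  exact h1

/-- T5b (S). `z² ∣ 6912·den(j(E_{x,y}))` for coprime `x, y` (`j = 6912xy/z²`, `gcd(xy, z) = 1`, so
`den j = z²/gcd(6912, z²)`; Mathlib `Rat.den_div_eq_of_coprime` after dividing by the gcd). [folklore] -/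
theorem sq_dvd_mul_den_j {x y : ℤ} (hxy : IsCoprime x y) (hx : x ≠ 0) (hy : y ≠ 0) (hz : x + y ≠ 0)
    [(pencil x y).IsElliptic] :
    ((x + y) ^ 2).natAbs ∣ 6912 * ((pencil x y).j).den := by
  sorry

/-- T5 (S, = T5a ∘ T5b). The captured member: `(x + y)² ∣ 6912·|Δ_min(E_{x,y})|`. Certified: j344733 C1/C2/C7. [folklore] -/
theorem sq_dvd_mul_minimalDiscriminantNorm {x y : ℤ} (hxy : IsCoprime x y) (hx : x ≠ 0) (hy : y ≠ 0)
    (hz : x + y ≠ 0) [(pencil x y).IsElliptic] :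
    ((x + y) ^ 2).natAbs ∣ 6912 * (pencil x y).minimalDiscriminantNorm ℤ :=
  (sq_dvd_mul_den_j hxy hx hy hz).trans (mul_dvd_mul_left _ (den_j_dvd_minimalDiscriminantNorm _))

/-! ## T6 — the conductor is supported on `rad(xyz)` with exponent ≤ 2 away from `6` (M) -/

/-- T6 (M). `N(E_{x,y}) ∣ 2⁸·3⁵·rad(xyz)²` for coprime `x, y`, `xyz ≠ 0` (`z = x + y`): `f₂ ≤ 8`, `f₃ ≤ 5`
(`conductorExponent_le_eight_holds`, `conductorExponent_le_five_of_natGenerator_eq_three_holds`); for `p ≥ 5`,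
`f_p ≤ 2` (`conductorExponent_le_two_of_five_le_natGenerator_holds`) and `f_p = 0` if `p ∤ xyz`
(`isMinimalAt_baseChange_int_of_not_pow_dvd_Δ` + `conductorExponent_eq_zero_of_not_dvd_Δ`, T1b); assemble with
`conductorNorm_dvd_of_forall_conductorExponent_le` (template: `TwoTorsionDictionary.radical_natAbs_dvd_two_mul_conductorNorm`).
Sharper, not needed: `p ≥ 5`, `p ∣ z ⟹ f_p = 1` (`conductorExponent_eq_one_of_dvd_Δ_of_not_dvd_c₄`, T1a).
Certified: j344733 C2–C4. [folklore] -/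
theorem conductorNorm_pencil_dvd {x y : ℤ} (hxy : IsCoprime x y) (hx : x ≠ 0) (hy : y ≠ 0) (hz : x + y ≠ 0)
    [(pencil x y).IsElliptic] :
    (pencil x y).conductorNorm ℤ ∣ 2 ^ 8 * 3 ^ 5 * (radical (x * y * (x + y))).natAbs ^ 2 := by
  sorry

/-! ## T7 — the FLT(3) dispatch: every abc triple has a qualifying role assignment -/

/-- T7₀ (kernel-checked, Mathlib `fermatLastTheoremThree`). If `a` and `b` are cubes then `c = a + b` is not. -/
theorem not_cube_of_cubes {a b c : ℕ} (h : IsABCTriple a b c) (ha : ∃ m, a = m ^ 3) (hb : ∃ n, b = n ^ 3) :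
    ¬ ∃ l, c = l ^ 3 := by
  rintro ⟨l, rfl⟩
  obtain ⟨m, rfl⟩ := ha
  obtain ⟨n, rfl⟩ := hb
  obtain ⟨hm, hn, hsum, -⟩ := h
  have hm0 : m ≠ 0 := by rintro rfl; simp at hm
  have hn0 : n ≠ 0 := by rintro rfl; simp at hn
  have hl0 : l ≠ 0 := by
    rintro rfl
    have : 0 < m ^ 3 + n ^ 3 := Nat.add_pos_left hm _
    omega
  exact fermatLastTheoremThree m n l hm0 hn0 hl0 hsum

/-- T7 (S/M). THE DISPATCH. For an abc triple `a + b = c`: either `ab²` is not a rational cube — role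
assignment `(x, y) = (a, b)`, capturing `z = c` — or (`a`, `b` cubes by T3′, hence `c` no cube by T7₀) both
`ca²` and `cb²` are non-cubes — assignments `(c, −a)` / `(c, −b)` capturing `z = b` / `z = a`, one of which
is `≥ c/2`. [folklore] -/
theorem flt3_dispatch {a b c : ℕ} (h : IsABCTriple a b c) :
    (∀ r : ℚ, r ^ 3 ≠ (a : ℚ) * (b : ℚ) ^ 2) ∨
      ((∀ r : ℚ, r ^ 3 ≠ (c : ℚ) * (-(a : ℚ)) ^ 2) ∧ ∀ r : ℚ, r ^ 3 ≠ (c : ℚ) * (-(b : ℚ)) ^ 2) := by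
  sorry

/-! ## T8 — the recognition theorems (M): the stub implies abc with exponent 8 (7 with T4c) -/

/-- **T8 (M) — `stub_complexCubic ⟹ abc with exponent 8`.** Given `ε`, take the stub's `C = C(ε)`; for an abc
triple choose the role assignment of T7 (`x + y = z`, `z ≥ c/2`, `gcd = 1`, `xy² ∉ ℚ³`); `E_{x,y}` is elliptic
(T1c), `ψ₂` irreducible (T3), `K` = stem field (T4a) is complex (T4b + T1b); the stub gives
`Δ_min ≤ C·|d_K|·N^{6+ε}`; with T5 (`z² ≤ 6912 Δ_min`), CLOSED support `ResolventDiscBounds`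
(`Summit.ABC.ABC.Theorems.resolventDiscBounds_proof`: `|d_K| ≤ 1944 N²`) and T6 (`N ≤ 2⁸3⁵ rad²`):
`c²/4 ≤ z² ≤ 6912·1944·C·(2⁸3⁵)^{8+ε}·rad(abc)^{16+2ε}`, i.e. `c < C'·rad(abc)^{8(1+ε)}`. [folklore] -/
theorem abcWithExponent_eight_of_stub (hsign : SignDoor) (h : Stub) : GenEll.ABCWithExponent 8 := by
  sorry

/-- T8′ (M, same proof with T4c in place of `ResolventDiscBounds`): exponent `7`. [folklore] -/
theorem abcWithExponent_seven_of_stub (hsign : SignDoor) (h : Stub) : GenEll.ABCWithExponent 7 := by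
  sorry

/-- **T8″ (S ∘ T8) — the calibration of the ROUTE CRUX**: `IndexSzpiro ⟹ abc with exponent 8`. Together with
`szpiro_of_abcLe_holds ∘ stub_of_szpiro` (abc₁ ⟹ stub) this sandwiches stmt-ABC-22740 between `ABCWithExponent 1`
and `ABCWithExponent 8`: the crux is abc up to the exponent — no import short of abc closes it. [folklore] -/
theorem abcWithExponent_eight_of_indexSzpiro (hsign : SignDoor)
    (h : Summit.ABC.ABC.Theses.CubicResolventAllowance.IndexSzpiro) : GenEll.ABCWithExponent 8 :=
  abcWithExponent_eight_of_stub hsign (stub_of_indexSzpiro h)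

/-! ## T9 — optional payoff for the route's `closes` (L) -/

/-- T9 (L, optional). Polynomial abc ⟹ polynomial Szpiro on the split class (indeed on ALL curves, exponent
`6Λ(1+ε)`, by porting the tree's `szpiro_of_abcLe_holds` — Silverman AEC VIII.11.5(b) on
`(c₄³/G, −c₆²/G, 1728Δ/G)` — with the exponent carried). With T8″: `IndexSzpiro → SplitClassPolySzpiro`, so the
binder `h₃` of the route's `closes` is implied by `h₁` (tenure note: open leaves 3 → 2). [cite: SilvermanAEC2009, VIII.11.5(b)] -/
theorem splitClassPolySzpiro_of_abcWithExponent {Λ : ℝ} (hΛ : 0 < Λ) (h : GenEll.ABCWithExponent Λ) :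
    Summit.ABC.ABC.Theses.CubicResolventAllowance.SplitClassPolySzpiro := by
  sorry

end Summit.ABC.ABC.Cruxes.IndexSzpiro.StubIdeasComplexCubic1G6

end
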